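import Summits.CriticalPhenomena.SAWScalingLimit.Theorems.SAWDefectDecoherenceBoundaryClosureRZigzagDiscretisationPins
import HarnessLib

/-!
# Crux `BoundaryClosureR` (stmt-CriticalPhenomena-14004), line `polygon-parity-squeeze`,
# stub `stub_innerPolygonsOfZigzag` (7b): the tests near a flat chart reduce to one test

Landing target:
`Summits/CriticalPhenomena/SAWScalingLimit/Theorems/SAWDefectDecoherenceBoundaryClosureRZigzagDiscretisationSide.lean`
(`--supports stmt-CriticalPhenomena-14004`; building block of the registered stub
`stub_innerPolygonsOfZigzag`, the lattice half of the inner-polygon construction (IP)).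

CONSISTENCY of the local tests of the trimmed discretisation near an `r`-far frontier point `z` with
flat chart of form `k`: for a face with scaled centre `p ∈ ball z (3r/8)`,

* `test_of_zdPass_side` — passing all tests forces `zdT k z ≤ zigzagForm k v` (if `p` is deep the
  margin rule applies; else the foot of `p` on the line is a frontier point within `r/8`, whose own
  test — or, if it is within `r` of a corner, the corner's test of the ray through `z` — is the test
  of `z`, thresholds being constant along frontier segments);
* `zdPass_of_side` — conversely `p ∈ P` and `zdT k z ≤ zigzagForm k v` pass ALL tests that see `p`
  (nearby flat charts are collinear with the same form; a corner chart within `3r/2` has `z` on one of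
  its rays, the ray's test is the test of `z` and the other form is passed/failed with margin `0.47r`);
* `ray_inter_facts`, `ray_union_facts` — the packaged ray geometry (form of the flat chart on a ray,
  the ray segment is a frontier segment, the other level is `±(√3/2)‖z - c‖`).

One mesh `δ`; hypotheses: the charts, pins at least the least thresholds, float margin
`δ(√3/6 + (√3/2)u) ≤ r/16`.  Sources: folklore.  No proposition is defined, no named fact introduced.
-/

noncomputable section

open scoped ComplexConjugate Topology
open Set Metric Filter
open Literature.Probability.LatticeModels Literature.Probability.RandomPlanarGeometry
  Literature.Probability.RandomPlanarGeometry.SAW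
open Summit.CriticalPhenomena.SAWScalingLimit.Theorems.PolygonParitySqueeze.InnerZigzag
  (level_split level_add_smul halfPlane_eq_of_level_eq_zero)

namespace Summit.CriticalPhenomena.SAWScalingLimit.Theorems.PolygonParitySqueeze.ZigzagDiscretisation

/-- `17/20 < √3/2`. [folklore] -/
theorem sqrt_three_div_two_gt : (17 : ℝ) / 20 < Real.sqrt 3 / 2 := by
  have : (17 : ℝ) / 10 < Real.sqrt 3 := by
    rw [Real.lt_sqrt (by norm_num)]; norm_num
  linarith

/-! ### 1. Packaged ray geometry -/

/-- **Ray facts at a convex corner chart**: `z` an `r`-far frontier point with flat chart of form `k`,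
inside the corner ball, on the line of `k₁`: then `k = k₁`, the segment `[c, z]` is a frontier segment,
and the other form `k₂` is `k₁` or has level `(√3/2)‖z - c‖` at `z`. [folklore] -/
theorem ray_inter_facts {S : Set ℂ} {k k₁ k₂ : Fin 6} {c z : ℂ} {r : ℝ} (hr : 0 < r)
    (hch : S ∩ ball c (2 * r) = halfPlane k₁ c ∩ halfPlane k₂ c ∩ ball c (2 * r))
    (hno : (innerNormal k₁ * conj (innerNormal k₂)).re ≠ -1) (hcF : c ∈ frontier S)
    (hzF : z ∈ frontier S) (hzB : z ∈ ball c (2 * r)) (hzc : z ≠ c)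
    (hk : S ∩ ball z (r / 2) = halfPlane k z ∩ ball z (r / 2))
    (h0 : ((z - c) * conj (innerNormal k₁)).re = 0) :
    k = k₁ ∧ segment ℝ c z ⊆ frontier S ∧
      (k₂ = k₁ ∨ ((z - c) * conj (innerNormal k₂)).re = Real.sqrt 3 / 2 * ‖z - c‖) := by
  have hother : k₂ = k₁ ∨ ((z - c) * conj (innerNormal k₂)).re = Real.sqrt 3 / 2 * ‖z - c‖ := by
    by_cases hkk : k₂ = k₁
    · exact Or.inl hkk
    · exact Or.inr (level_other_of_ray_inter hch hno hkk hzF hzB hzc h0)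
  have hpos : 0 < ((z - c) * conj (innerNormal k₂)).re ∨ k₂ = k₁ := by
    rcases hother with h | h
    · exact Or.inr h
    · left; rw [h]
      have : 0 < ‖z - c‖ := norm_pos_iff.2 (sub_ne_zero.2 hzc)
      positivity
  refine ⟨eq_of_halfBall_subset_chart (by positivity) (halfBall_subset_of_ray_inter hch hzB h0 hpos) hk,
    segment_subset_frontier_ray_inter hch hcF hzB h0 hpos, hother⟩

/-- **Ray facts at a reflex corner chart** (other level `-(√3/2)‖z - c‖`). [folklore] -/
theorem ray_union_facts {S : Set ℂ} {k k₁ k₂ : Fin 6} {c z : ℂ} {r : ℝ} (hr : 0 < r)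
    (hch : S ∩ ball c (2 * r) = (halfPlane k₁ c ∪ halfPlane k₂ c) ∩ ball c (2 * r))
    (hno : (innerNormal k₁ * conj (innerNormal k₂)).re ≠ -1)
    (hzF : z ∈ frontier S) (hzB : z ∈ ball c (2 * r)) (hzc : z ≠ c)
    (hk : S ∩ ball z (r / 2) = halfPlane k z ∩ ball z (r / 2))
    (h0 : ((z - c) * conj (innerNormal k₁)).re = 0) :
    k = k₁ ∧ segment ℝ c z ⊆ frontier S ∧
      (k₂ = k₁ ∨ ((z - c) * conj (innerNormal k₂)).re = -(Real.sqrt 3 / 2 * ‖z - c‖)) := by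
  have hother : k₂ = k₁ ∨ ((z - c) * conj (innerNormal k₂)).re = -(Real.sqrt 3 / 2 * ‖z - c‖) := by
    by_cases hkk : k₂ = k₁
    · exact Or.inl hkk
    · exact Or.inr (level_other_of_ray_union hch hno hkk hzF hzB hzc h0)
  have hnonpos : ((z - c) * conj (innerNormal k₂)).re ≤ 0 := by
    rcases hother with h | h
    · rw [h, h0]
    · rw [h]
      have : 0 ≤ Real.sqrt 3 / 2 * ‖z - c‖ := by positivity
      linarith
  exact ⟨eq_of_halfBall_subset_chart (by positivity) (halfBall_subset_of_ray_union hch hzB h0) hk,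
    segment_subset_frontier_ray_union hch hzB h0 hnonpos, hother⟩

/-! ### 2. The tests near a flat chart -/

section OneMesh

variable {D : DobrushinDomain} {S : Set ℂ} {Cor : Finset ℂ} {κ : ℂ → Fin 6 × Fin 6 × Bool} {r ρ r₁ δ : ℝ}
  {x₁ x₀ : ℂ} {m m₀ : ℤ}

/-- **Passing all tests forces the test of the flat chart** (`p ∈ ball z (3r/8)`). [folklore] -/
theorem test_of_zdPass_side (hr : 0 < r) (hδ : 0 < δ)
    (hD1 : D.carrier ∩ ball x₁ ρ = {z : ℂ | x₁.im < z.im} ∩ ball x₁ ρ)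
    (hD0 : D.carrier ∩ ball x₀ r₁ = {z : ℂ | x₀.im < z.im} ∩ ball x₀ r₁)
    (hF : ∀ w ∈ frontier S, w ∉ ball x₁ (15 * ρ / 16) → w ∉ ball x₀ (15 * r₁ / 16) → w ∈ D.carrier)
    (hsep01 : ρ + r₁ ≤ dist x₀ x₁) (hρ : 0 ≤ ρ) (hr₁ : 0 ≤ r₁)
    (hCor : ∀ c ∈ Cor, c ∈ frontier S)
    (hsep : ∀ c ∈ Cor, ∀ c' ∈ Cor, c ≠ c' → 4 * r ≤ dist c c')
    (hflat : ∀ z ∈ frontier S, (∀ c ∈ Cor, r ≤ dist z c) → ∃ k : Fin 6, S ∩ ball z (r / 2) = halfPlane k z ∩ ball z (r / 2))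
    (Hκ : ∀ c ∈ Cor, ((κ c).2.2 = true ∧ S ∩ ball c (2 * r) = halfPlane (κ c).1 c ∩ halfPlane (κ c).2.1 c ∩ ball c (2 * r)) ∨
      ((κ c).2.2 = false ∧ S ∩ ball c (2 * r) = (halfPlane (κ c).1 c ∪ halfPlane (κ c).2.1 c) ∩ ball c (2 * r)))
    (hmargin : δ * (Real.sqrt 3 / 6 + Real.sqrt 3 / 2 * ((|m - zdThr 0 x₁ δ| + |m₀ - zdThr 0 x₀ δ| + 2 : ℤ) : ℝ)) ≤ r / 16)
    {z : ℂ} (hzF : z ∈ frontier S) (hfar : ∀ c ∈ Cor, r ≤ dist z c) {k : Fin 6}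
    (hk : S ∩ ball z (r / 2) = halfPlane k z ∩ ball z (r / 2))
    {v : HexVertex} (hv : zdPass S Cor κ r (zdT x₁ x₀ ρ r₁ m m₀ δ) δ v = true)
    (hpz : (δ : ℂ) * hexCenter v ∈ ball z (3 * r / 8)) :
    zdT x₁ x₀ ρ r₁ m m₀ δ k z ≤ zigzagForm k v := by
  have hs := sqrt_three_div_two_gt
  have h3p : 0 < Real.sqrt 3 := Real.sqrt_pos.2 (by norm_num)
  set U : ℤ := |m - zdThr 0 x₁ δ| + |m₀ - zdThr 0 x₀ δ| + 2 with hU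
  have hU0 : (0 : ℝ) ≤ U := by
    have h1 := abs_nonneg (m - zdThr 0 x₁ δ); have h2 := abs_nonneg (m₀ - zdThr 0 x₀ δ)
    have : (0 : ℤ) ≤ U := by rw [hU]; linarith
    exact_mod_cast this
  have hmU : δ * (Real.sqrt 3 / 2 * U) ≤ r / 16 := by nlinarith
  rw [zdPass_iff] at hv
  obtain ⟨hpS, hside, hcorner⟩ := hv
  set p : ℂ := (δ : ℂ) * hexCenter v with hp
  have hpz' : dist p z < 3 * r / 8 := mem_ball.1 hpz
  have hpB : p ∈ ball z (r / 2) := mem_ball.2 (by linarith)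
  have hpH : p ∈ halfPlane k z := by
    have : p ∈ S ∩ ball z (r / 2) := ⟨hpS, hpB⟩
    rw [hk] at this; exact this.1
  set ℓ : ℝ := ((p - z) * conj (innerNormal k)).re with hℓ
  have hℓ0 : 0 < ℓ := (mem_halfPlane_iff_level k z p).1 hpH
  by_cases hdeep : δ * (Real.sqrt 3 / 6 + Real.sqrt 3 / 2 * U) < ℓ
  · exact zdT_le_of_lt_level x₁ x₀ ρ r₁ m m₀ hδ k z v (by rw [← hp, ← hℓ]; exact hdeep)
  push Not at hdeep
  have hℓr : ℓ ≤ r / 16 := hdeep.trans hmargin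
  -- the foot point `q`
  set q : ℂ := p + ((-ℓ : ℝ) : ℂ) * innerNormal k with hq
  have hq0 : ((q - z) * conj (innerNormal k)).re = 0 := by
    rw [hq, level_add_real_mul_innerNormal_self, ← hℓ]; ring
  have hpq : dist p q = ℓ := by
    rw [hq, dist_eq_norm, sub_add_cancel_left, norm_neg, norm_mul, norm_innerNormal, Complex.norm_real,
      Real.norm_eq_abs, abs_of_neg (by linarith), mul_one, neg_neg]
  have hqz : dist q z < r / 2 := by
    calc dist q z ≤ dist q p + dist p z := dist_triangle _ _ _
      _ < ℓ + 3 * r / 8 := by rw [dist_comm, hpq]; linarith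
      _ ≤ r / 2 := by linarith
  have hqB : q ∈ ball z (r / 2) := mem_ball.2 hqz
  have hqF : q ∈ frontier S := mem_frontier_of_line hk hqB hq0
  have hpq8 : dist p q < r / 8 := by rw [hpq]; linarith
  by_cases hqfar : ∀ c ∈ Cor, r ≤ dist q c
  · obtain ⟨j, hj⟩ := hflat q hqF hqfar
    have hjk : j = k := eq_of_flat_charts (by positivity) hk hqB hq0 hj
    subst hjk
    have hT := hside q hqF hqfar hpq8 j hj
    rwa [zdT_eq_of_segment hD1 hD0 hF hsep01 hρ hr₁ m m₀ δ j (segment_subset_frontier_flat hk hqB hq0) hq0] at hT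
  · push Not at hqfar
    obtain ⟨c, hc, hqc⟩ := hqfar
    have hzc' : dist z c < 2 * r := by
      calc dist z c ≤ dist z q + dist q c := dist_triangle _ _ _
        _ < r / 2 + r := by rw [dist_comm]; linarith
        _ < 2 * r := by linarith
    have hzB : z ∈ ball c (2 * r) := mem_ball.2 hzc'
    have hzc : z ≠ c := by
      intro h; have := hfar c hc; rw [h, dist_self] at this; linarith
    have hzcr : r ≤ ‖z - c‖ := by rw [← dist_eq_norm]; exact hfar c hc
    have hpc : dist p c < 3 * r / 2 := by
      calc dist p c ≤ dist p q + dist q c := dist_triangle _ _ _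
        _ < r / 8 + r := by linarith
        _ < 3 * r / 2 := by linarith
    have hcF := hCor c hc
    have hno := corner_not_opposite hr hCor hsep hflat Hκ hc
    have hno' : (innerNormal (κ c).2.1 * conj (innerNormal (κ c).1)).re ≠ -1 := by rwa [inner_innerNormal_comm]
    obtain ⟨hconv, hrefl⟩ := hcorner c hc hpc
    -- the test of the ray's form at `c` equals the test at `z`
    have transfer : ∀ {k' : Fin 6}, k = k' → segment ℝ c z ⊆ frontier S →
        ((z - c) * conj (innerNormal k')).re = 0 →
        zdT x₁ x₀ ρ r₁ m m₀ δ k' c ≤ zigzagForm k' v → zdT x₁ x₀ ρ r₁ m m₀ δ k z ≤ zigzagForm k v := by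
      rintro k' rfl hseg h0 hT
      rwa [zdT_eq_of_segment hD1 hD0 hF hsep01 hρ hr₁ m m₀ δ k hseg h0]
    -- the other form of a reflex corner fails with margin
    have reflex_other : ∀ {k₂ : Fin 6}, ((z - c) * conj (innerNormal k₂)).re = -(Real.sqrt 3 / 2 * ‖z - c‖) →
        ¬ zdT x₁ x₀ ρ r₁ m m₀ δ k₂ c ≤ zigzagForm k₂ v := by
      intro k₂ hlev
      apply not_zdT_le_of_level_le x₁ x₀ ρ r₁ m m₀ hδ k₂ c v
      rw [← hp, level_split (innerNormal k₂) p c z, hlev]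
      have h1 := abs_level_le_dist k₂ z p
      have h2 := le_abs_self ((p - z) * conj (innerNormal k₂)).re
      have h4 : 17 / 20 * r ≤ Real.sqrt 3 / 2 * ‖z - c‖ := by nlinarith [norm_nonneg (z - c)]
      have hmU' : δ * (Real.sqrt 3 / 2 * ((|m - zdThr 0 x₁ δ| + |m₀ - zdThr 0 x₀ δ| + 2 : ℤ) : ℝ)) ≤ r / 16 := hmU
      push_cast at hmU' ⊢
      linarith
    rcases Hκ c hc with ⟨hb, hch⟩ | ⟨hb, hch⟩
    · obtain ⟨hT1, hT2⟩ := hconv hb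
      rcases frontier_of_inter_chart hch hzF hzB with ⟨h0, -⟩ | ⟨h0, -⟩
      · obtain ⟨hk1, hseg, -⟩ := ray_inter_facts hr hch hno hcF hzF hzB hzc hk h0
        exact transfer hk1 hseg h0 hT1
      · rw [inter_comm (halfPlane (κ c).1 c)] at hch
        obtain ⟨hk1, hseg, -⟩ := ray_inter_facts hr hch hno' hcF hzF hzB hzc hk h0
        exact transfer hk1 hseg h0 hT2
    · have hT := hrefl hb
      rcases frontier_of_union_chart hch hzF hzB with ⟨h0, -⟩ | ⟨h0, -⟩
      · obtain ⟨hk1, hseg, hother⟩ := ray_union_facts hr hch hno hzF hzB hzc hk h0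
        rcases hT with hT | hT
        · exact transfer hk1 hseg h0 hT
        · rcases hother with heq | hlev
          · rw [heq] at hT; exact transfer hk1 hseg h0 hT
          · exact absurd hT (reflex_other hlev)
      · rw [union_comm] at hch
        obtain ⟨hk1, hseg, hother⟩ := ray_union_facts hr hch hno' hzF hzB hzc hk h0
        rcases hT with hT | hT
        · rcases hother with heq | hlev
          · rw [heq] at hT; exact transfer hk1 hseg h0 hT
          · exact absurd hT (reflex_other hlev)
        · exact transfer hk1 hseg h0 hT

/-- **`p ∈ P` and the test of the flat chart pass all tests that see `p`** (`p ∈ ball z (3r/8)`).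
[folklore] -/
theorem zdPass_of_side (hr : 0 < r) (hδ : 0 < δ)
    (hD1 : D.carrier ∩ ball x₁ ρ = {z : ℂ | x₁.im < z.im} ∩ ball x₁ ρ)
    (hD0 : D.carrier ∩ ball x₀ r₁ = {z : ℂ | x₀.im < z.im} ∩ ball x₀ r₁)
    (hF : ∀ w ∈ frontier S, w ∉ ball x₁ (15 * ρ / 16) → w ∉ ball x₀ (15 * r₁ / 16) → w ∈ D.carrier)
    (hsep01 : ρ + r₁ ≤ dist x₀ x₁) (hρ : 0 ≤ ρ) (hr₁ : 0 ≤ r₁)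
    (hCor : ∀ c ∈ Cor, c ∈ frontier S)
    (hsep : ∀ c ∈ Cor, ∀ c' ∈ Cor, c ≠ c' → 4 * r ≤ dist c c')
    (hflat : ∀ z ∈ frontier S, (∀ c ∈ Cor, r ≤ dist z c) → ∃ k : Fin 6, S ∩ ball z (r / 2) = halfPlane k z ∩ ball z (r / 2))
    (Hκ : ∀ c ∈ Cor, ((κ c).2.2 = true ∧ S ∩ ball c (2 * r) = halfPlane (κ c).1 c ∩ halfPlane (κ c).2.1 c ∩ ball c (2 * r)) ∨
      ((κ c).2.2 = false ∧ S ∩ ball c (2 * r) = (halfPlane (κ c).1 c ∪ halfPlane (κ c).2.1 c) ∩ ball c (2 * r)))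
    (hmargin : δ * (Real.sqrt 3 / 6 + Real.sqrt 3 / 2 * ((|m - zdThr 0 x₁ δ| + |m₀ - zdThr 0 x₀ δ| + 2 : ℤ) : ℝ)) ≤ r / 16)
    {z : ℂ} (hzF : z ∈ frontier S) (hfar : ∀ c ∈ Cor, r ≤ dist z c) {k : Fin 6}
    (hk : S ∩ ball z (r / 2) = halfPlane k z ∩ ball z (r / 2))
    {v : HexVertex} (hpS : (δ : ℂ) * hexCenter v ∈ S) (hT : zdT x₁ x₀ ρ r₁ m m₀ δ k z ≤ zigzagForm k v)
    (hpz : (δ : ℂ) * hexCenter v ∈ ball z (3 * r / 8)) :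
    zdPass S Cor κ r (zdT x₁ x₀ ρ r₁ m m₀ δ) δ v = true := by
  have hs := sqrt_three_div_two_gt
  have h3p : 0 < Real.sqrt 3 := Real.sqrt_pos.2 (by norm_num)
  set p : ℂ := (δ : ℂ) * hexCenter v with hp
  have hpz' : dist p z < 3 * r / 8 := mem_ball.1 hpz
  rw [zdPass_iff]
  refine ⟨hpS, ?_, ?_⟩
  · -- nearby flat charts: collinear, same form, same threshold
    intro z' hz'F _ hpz8 j hj
    have hzz : dist z' z < r / 2 := by
      calc dist z' z ≤ dist z' p + dist p z := dist_triangle _ _ _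
        _ < r / 8 + 3 * r / 8 := by rw [dist_comm]; linarith
        _ = r / 2 := by ring
    have hz'B : z' ∈ ball z (r / 2) := mem_ball.2 hzz
    have hl : ((z' - z) * conj (innerNormal k)).re = 0 := by
      have := frontier_of_flat_chart hk
      have hmem : z' ∈ frontier S ∩ ball z (r / 2) := ⟨hz'F, hz'B⟩
      rw [this] at hmem; exact hmem.1
    have hjk : j = k := eq_of_flat_charts (by positivity) hk hz'B hl hj
    subst hjk
    rwa [zdT_eq_of_segment hD1 hD0 hF hsep01 hρ hr₁ m m₀ δ j (segment_subset_frontier_flat hk hz'B hl) hl]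
  · -- corner charts within `3r/2`
    intro c hc hpc
    have hzc' : dist z c < 2 * r := by
      calc dist z c ≤ dist z p + dist p c := dist_triangle _ _ _
        _ < 3 * r / 8 + 3 * r / 2 := by rw [dist_comm]; linarith
        _ < 2 * r := by linarith
    have hzB : z ∈ ball c (2 * r) := mem_ball.2 hzc'
    have hzc : z ≠ c := by
      intro h; have := hfar c hc; rw [h, dist_self] at this; linarith
    have hzcr : r ≤ ‖z - c‖ := by rw [← dist_eq_norm]; exact hfar c hc
    have hcF := hCor c hc
    have hno := corner_not_opposite hr hCor hsep hflat Hκ hc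
    have hno' : (innerNormal (κ c).2.1 * conj (innerNormal (κ c).1)).re ≠ -1 := by rwa [inner_innerNormal_comm]
    -- transfer of the given test to the ray's form at `c`
    have transfer : ∀ {k' : Fin 6}, k = k' → segment ℝ c z ⊆ frontier S →
        ((z - c) * conj (innerNormal k')).re = 0 → zdT x₁ x₀ ρ r₁ m m₀ δ k' c ≤ zigzagForm k' v := by
      rintro k' rfl hseg h0
      rw [zdT_eq_of_segment hD1 hD0 hF hsep01 hρ hr₁ m m₀ δ k hseg h0] at hT
      exact hT
    -- the other form of a convex corner passes with margin
    have convex_other : ∀ {k₂ : Fin 6}, ((z - c) * conj (innerNormal k₂)).re = Real.sqrt 3 / 2 * ‖z - c‖ →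
        zdT x₁ x₀ ρ r₁ m m₀ δ k₂ c ≤ zigzagForm k₂ v := by
      intro k₂ hlev
      apply zdT_le_of_lt_level x₁ x₀ ρ r₁ m m₀ hδ k₂ c v
      rw [← hp, level_split (innerNormal k₂) p c z, hlev]
      have h1 := abs_level_le_dist k₂ z p
      have h2 := neg_abs_le ((p - z) * conj (innerNormal k₂)).re
      have h4 : 17 / 20 * r ≤ Real.sqrt 3 / 2 * ‖z - c‖ := by nlinarith [norm_nonneg (z - c)]
      linarith
    rcases Hκ c hc with ⟨hb, hch⟩ | ⟨hb, hch⟩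
    · rw [hb]
      refine ⟨fun _ => ?_, fun h => absurd h (by decide)⟩
      rcases frontier_of_inter_chart hch hzF hzB with ⟨h0, -⟩ | ⟨h0, -⟩
      · obtain ⟨hk1, hseg, hother⟩ := ray_inter_facts hr hch hno hcF hzF hzB hzc hk h0
        refine ⟨transfer hk1 hseg h0, ?_⟩
        rcases hother with heq | hlev
        · rw [heq]; exact transfer hk1 hseg h0
        · exact convex_other hlev
      · have hch' := hch
        rw [inter_comm (halfPlane (κ c).1 c)] at hch'
        obtain ⟨hk1, hseg, hother⟩ := ray_inter_facts hr hch' hno' hcF hzF hzB hzc hk h0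
        refine ⟨?_, transfer hk1 hseg h0⟩
        rcases hother with heq | hlev
        · rw [heq]; exact transfer hk1 hseg h0
        · exact convex_other hlev
    · rw [hb]
      refine ⟨fun h => absurd h (by decide), fun _ => ?_⟩
      rcases frontier_of_union_chart hch hzF hzB with ⟨h0, -⟩ | ⟨h0, -⟩
      · obtain ⟨hk1, hseg, -⟩ := ray_union_facts hr hch hno hzF hzB hzc hk h0
        exact Or.inl (transfer hk1 hseg h0)
      · have hch' := hch
        rw [union_comm] at hch'
        obtain ⟨hk1, hseg, -⟩ := ray_union_facts hr hch' hno' hzF hzB hzc hk h0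
        exact Or.inr (transfer hk1 hseg h0)

end OneMesh

/-- **Ray facts at a convex corner chart** (registered form, sub-goal of `stub_innerPolygonsOfZigzag`). [folklore] -/
theorem zd_ray_inter_facts : ∀ (S : Set ℂ) (k k₁ k₂ : Fin 6) (c z : ℂ) (r : ℝ), 0 < r → S ∩ Metric.ball c (2 * r) = halfPlane k₁ c ∩ halfPlane k₂ c ∩ Metric.ball c (2 * r) → (innerNormal k₁ * (starRingEnd ℂ) (innerNormal k₂)).re ≠ -1 → c ∈ frontier S → z ∈ frontier S → z ∈ Metric.ball c (2 * r) → z ≠ c → S ∩ Metric.ball z (r / 2) = halfPlane k z ∩ Metric.ball z (r / 2) → ((z - c) * (starRingEnd ℂ) (innerNormal k₁)).re = 0 → k = k₁ ∧ segment ℝ c z ⊆ frontier S ∧ (k₂ = k₁ ∨ ((z - c) * (starRingEnd ℂ) (innerNormal k₂)).re = Real.sqrt 3 / 2 * ‖z - c‖) :=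
  fun _ _ _ _ _ _ _ hr hch hno hcF hzF hzB hzc hk h0 => ray_inter_facts hr hch hno hcF hzF hzB hzc hk h0

end Summit.CriticalPhenomena.SAWScalingLimit.Theorems.PolygonParitySqueeze.ZigzagDiscretisation

end
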